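import Summits.RiemannHypothesis.RiemannHypothesis.Theorems.PfPersistenceEdgeLawCutBound
import Summits.RiemannHypothesis.RiemannHypothesis.Theorems.PfPersistenceEdgeLawOneSided
import Summits.RiemannHypothesis.RiemannHypothesis.Theorems.PfPersistenceEdgeLawCornerFormula
import Summits.RiemannHypothesis.RiemannHypothesis.Theorems.PfPersistenceEdgeLawLayerEnergy

/-!
# The SHARP UPPER HALF of the edge law (pub-rhpf theory-2, gen 5; RH-free)

Mechanism / rigidity campaign; no RH claims. RH-free helper theorems (item
stmt-RiemannHypothesis-19953, `--as helper`).

**Theorem (upper edge law, unconditional).** Let `u` be a Weil ground state of the window `a`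
whose edge masses satisfy `log(1/r)/r · m_u(r) ≤ I` for small `r` (e.g. `HasEdgeIntensity u a I`).
Then for every `δ > 0`, for all small `h > 0`,
`ε(a − h) − ε(a) ≤ (I + δ)·h` (`ε = weilGroundEnergy`):
`exists_sub_weilGroundEnergy_le_of_edgeMass`. The constant is exactly `2c₀ = 1`
(`edgeLawKernelConstant = 1/2`), matching the lower bound `V ≥ 2c₀·a·I` of
`virial_ge_of_interiorRegular`. Proof: cut `u` off by the steep ramp `steepCut (a − h) (ηh)` and
bound the energy of the cut state (`cut_energy_bound`): the archimedean kernel's `1/(2|t|)`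
singularity integrated against the edge profile `I/log(1/s)` over `|t| ≤ κh` produces exactly
`(1 + η)·I·(1 + η)h`, everything else is `O(h/√log(1/h))` (`cutErr_le`, same file as `cut_energy_bound`).

Consequences at a differentiability window `a` of `ε` (almost every `a`): `−ε'(a) ≤ I`
(`neg_deriv_weilGroundEnergy_le_of_hasEdgeIntensity`), `V ≤ 2c₀·a·I` for the dilation virial
(`virial_le_of_hasEdgeIntensity`); together with gen 4's lower half under the interior
regularity (R3): `V = 2c₀·a·I`, `ε'(a) = −2c₀·I`, `WeilLogPohozaevAt a`, and the corner energy is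
`o(h)` — i.e. (R3) alone implies (R2′) at such windows.

Sources: E. Bombieri, *Remarks on Weil's quadratic functional in the theory of prime numbers I*,
Rend. Mat. Acc. Lincei (9) 11 (2000) §4 Thm 3, §6; folklore (Hadamard variation).
-/

set_option linter.dupNamespace false

noncomputable section

open MeasureTheory Set Filter
open scoped Topology ENNReal NNReal

namespace Summit.RiemannHypothesis.RiemannHypothesis.Theorems.PfPersistence

open Literature.NumberTheory.LFunctions
open Summit.RiemannHypothesis.RiemannHypothesis.Theorems.WeilWindowFlowWindowLipschitz

variable {a : ℝ} {u : ℝ → ℂ}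

set_option maxHeartbeats 800000 in
/-- **Upper edge law.** If the edge masses of a ground state `u` of the window `a` satisfy
`log(1/r)/r · m_u(r) ≤ I` for `0 < r ≤ r₁`, then for every `δ > 0` there is `h₀ > 0` with
`ε(a − h) − ε(a) ≤ (I + δ)h` for `0 < h ≤ h₀`. [cite: Bombieri2000Weil, §6] -/
theorem exists_sub_weilGroundEnergy_le_of_edgeMass (hu : IsWeilGroundState a u) {I r₁ : ℝ}
    (hr₁ : 0 < r₁) (hIr : ∀ r, 0 < r → r ≤ r₁ → Real.log (1 / r) / r * edgeMass u a r ≤ I)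
    {δ : ℝ} (hδ : 0 < δ) :
    ∃ h₀ : ℝ, 0 < h₀ ∧ ∀ h : ℝ, 0 < h → h ≤ h₀ →
      weilGroundEnergy (a - h) - weilGroundEnergy a ≤ (I + δ) * h := by
  have ha : 0 < a := hu.pos
  -- `I ≥ 0`
  have hI0 : 0 ≤ I := by
    have hr : 0 < min r₁ (1 / 2) := lt_min hr₁ (by norm_num)
    have hr1 : min r₁ (1 / 2) < 1 := (min_le_right _ _).trans_lt (by norm_num)
    have hpos : 0 < Real.log (1 / min r₁ (1 / 2)) / min r₁ (1 / 2) :=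
      div_pos (stub_surplusReduction_log_pos hr hr1) hr
    have hm : 0 ≤ edgeMass u a (min r₁ (1 / 2)) := integral_nonneg fun _ ↦ by positivity
    exact (mul_nonneg hpos.le hm).trans (hIr _ hr (min_le_left _ _))
  -- the pointwise edge law, the sup bound; normalisation
  obtain ⟨KP₀, d₀, hd₀, hd₀1, hPW⟩ := stub_comparison stub_barrierEnergy
    (windowLipschitz_weakSurplus (windowLipschitz_surplus stub_surplusReduction
      stub_surplusCalculus) stub_barrierWeakForm) a a ha le_rfl
  obtain ⟨K₁, -, hK₁⟩ := exists_ae_norm_le hu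
  obtain ⟨v, hvm, hvu, hv0, hvK, hvP⟩ := cut_normalise hu hK₁ (hPW a u le_rfl le_rfl hu)
  have hgs : IsWeilGroundState a v := hu.congr_ae hvu.symm
  have hK0 : 0 ≤ max K₁ 0 := le_max_right _ _
  have hKP0 : 0 ≤ max KP₀ 0 := le_max_right _ _
  have hP : ∀ x, 0 < a - |x| → a - |x| < d₀ →
      ‖v x‖ ^ 2 * Real.log (1 / (a - |x|)) ≤ max KP₀ 0 :=
    fun x h1 h2 ↦ hvP x (by linarith) (by linarith)
  -- the radius `r₀`
  set r₀ : ℝ := min r₁ (min d₀ (a / 2)) with hr₀def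
  have hr₀ : 0 < r₀ := lt_min hr₁ (lt_min hd₀ (by positivity))
  have hr₀r₁ : r₀ ≤ r₁ := min_le_left _ _
  have hr₀d : r₀ ≤ d₀ := (min_le_right _ _).trans (min_le_left _ _)
  have hr₀a : 2 * r₀ ≤ a := by
    have := (min_le_right r₁ _).trans (min_le_right d₀ (a / 2))
    linarith
  have hr₀1 : r₀ < 1 := hr₀d.trans_lt hd₀1
  -- the edge masses of `v`
  have hB : ∀ r, 0 < r → r ≤ r₀ →
      ∫ x in {x : ℝ | a - r < |x|}, ‖v x‖ ^ 2 ≤ I * r / Real.log (1 / r) := by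
    intro r hr hrr
    have heq : ∫ x in {x : ℝ | a - r < |x|}, ‖v x‖ ^ 2 = edgeMass u a r :=
      integral_congr_ae (ae_restrict_of_ae (hvu.mono fun x hx ↦ by simp only [hx]))
    rw [heq]
    have hL : 0 < Real.log (1 / r) := stub_surplusReduction_log_pos hr (by linarith)
    have h1 := hIr r hr (hrr.trans hr₀r₁)
    have h2 := mul_le_mul_of_nonneg_right h1 hr.le
    have h3 : Real.log (1 / r) / r * edgeMass u a r * r = edgeMass u a r * Real.log (1 / r) := by
      field_simp
    rw [le_div_iff₀ hL]
    linarith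
  -- the parameters `η`, `κ`
  set η : ℝ := min 1 (δ / (12 * (I + 1))) with hηdef
  have hη : 0 < η := lt_min one_pos (by positivity)
  have hη1 : η ≤ 1 := min_le_left _ _
  have hηI : 3 * η * I ≤ δ / 4 := by
    have h1 : η ≤ δ / (12 * (I + 1)) := min_le_right _ _
    rw [le_div_iff₀ (by positivity)] at h1
    nlinarith [hη.le, hI0]
  set κ : ℝ := (1 + η) ^ 2 / η with hκdef
  have hκ2 : 2 * (1 + η) ≤ κ := by
    rw [hκdef, le_div_iff₀ hη]
    have : η * η ≤ 1 * 1 := mul_le_mul hη1 hη1 hη.le zero_le_one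
    nlinarith
  have hκ0 : 0 < κ := by positivity
  have hθ : ∀ h : ℝ, 0 < h → κ * h / (κ * h - (h + η * h)) = 1 + η := by
    intro h hh
    have hden : κ * h - (h + η * h) = (1 + η) / η * h := by
      rw [hκdef]
      field_simp
      ring
    rw [hden, hκdef, div_eq_iff (by positivity)]
    field_simp
  -- the error constant and the thresholds
  obtain ⟨C, hC0, hC⟩ := cutErr_le (K := max K₁ 0) (KP := max KP₀ 0) (I := I) (r₀ := r₀)
    ha hη hκ2 hr₀ hK0 hKP0 hI0
  set L₀ : ℝ := max 1 ((4 * C / δ) ^ 2) with hL₀def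
  set t₅ : ℝ := min (1 / (4 * (I + 1))) (δ / (4 * (I + 1) * (2 * I + δ))) with ht₅def
  have ht₅ : 0 < t₅ := lt_min (by positivity) (by positivity)
  set h₀ : ℝ := min (r₀ / κ) (min (Real.exp (-L₀) / κ) (min 1 t₅)) with hh₀def
  have hh₀ : 0 < h₀ := lt_min (by positivity) (lt_min (by positivity) (lt_min one_pos ht₅))
  refine ⟨h₀, hh₀, fun h hh hhh₀ ↦ ?_⟩
  have hκr : κ * h ≤ r₀ := by
    have := hhh₀.trans (min_le_left _ _)
    rwa [le_div_iff₀ hκ0, mul_comm] at this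
  have hκL : κ * h ≤ Real.exp (-L₀) := by
    have := hhh₀.trans ((min_le_right _ _).trans (min_le_left _ _))
    rwa [le_div_iff₀ hκ0, mul_comm] at this
  have hh1 : h ≤ 1 :=
    hhh₀.trans ((min_le_right _ _).trans ((min_le_right _ _).trans (min_le_left _ _)))
  have hht₅ : h ≤ t₅ :=
    hhh₀.trans ((min_le_right _ _).trans ((min_le_right _ _).trans (min_le_right _ _)))
  have hL₀1 : 1 ≤ L₀ := le_max_left _ _
  have hκe : κ * h ≤ Real.exp (-1) := hκL.trans (Real.exp_le_exp.2 (by linarith))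
  have hκh0 : 0 < κ * h := by positivity
  have hLR : L₀ ≤ Real.log (1 / (κ * h)) := le_log_one_div_of_le_exp_neg hκh0 hκL
  have hLR1 : 1 ≤ Real.log (1 / (κ * h)) := hL₀1.trans hLR
  have hHκ2 : 2 * (h + η * h) ≤ κ * h := by
    have := mul_le_mul_of_nonneg_right hκ2 hh.le
    linarith
  have hH : 0 < h + η * h := by positivity
  have hLH1 : 1 ≤ Real.log (1 / (h + η * h)) :=
    hLR1.trans (log_one_div_antitone hH (by linarith))
  -- the cut energy bound and the error bound
  have hmain := cut_energy_bound hvm hgs hv0 hvK hP hB hh (by positivity : 0 < η * h)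
    hHκ2 hκr hr₀d hd₀1 hr₀a hKP0 hI0
  rw [hθ h hh] at hmain
  have hE := hC h hh hh1 hκe
  set sR := Real.sqrt (Real.log (1 / (κ * h))) with hsRdef
  have hsR : 0 < sR := Real.sqrt_pos.2 (by linarith)
  have hsRC : 4 * C / δ ≤ sR := by
    have h1 : (4 * C / δ) ^ 2 ≤ Real.log (1 / (κ * h)) := (le_max_right _ _).trans hLR
    calc 4 * C / δ = Real.sqrt ((4 * C / δ) ^ 2) := (Real.sqrt_sq (by positivity)).symm
      _ ≤ sR := Real.sqrt_le_sqrt h1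
  have hE' : C * h / sR ≤ δ / 4 * h := by
    rw [div_le_iff₀ hsR]
    have h1 : δ / 4 * h * (4 * C / δ) = C * h := by
      field_simp
    calc C * h = δ / 4 * h * (4 * C / δ) := h1.symm
      _ ≤ δ / 4 * h * sR := mul_le_mul_of_nonneg_left hsRC (by positivity)
  -- the main term
  have hM : (1 + η) * I * (h + η * h) ≤ (I + δ / 4) * h := by
    have h1 : (1 + η) * I * (h + η * h) = (I + (2 * η + η * η) * I) * h := by ring
    have h2 : η * η * I ≤ η * I := by
      have : η * η ≤ η := by nlinarith
      exact mul_le_mul_of_nonneg_right this hI0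
    have h3 : (I + (2 * η + η * η) * I) * h ≤ (I + δ / 4) * h :=
      mul_le_mul_of_nonneg_right (by linarith) hh.le
    linarith
  -- the mass defect
  set μ : ℝ := I * (h + η * h) / Real.log (1 / (h + η * h)) with hμdef
  have hμ0 : 0 ≤ μ := div_nonneg (by positivity) (by linarith)
  have hμ : μ ≤ 2 * I * h := by
    calc μ ≤ I * (h + η * h) / 1 := div_le_div_of_nonneg_left (by positivity) one_pos hLH1
      _ = (1 + η) * I * h := by ring
      _ ≤ 2 * I * h :=
          mul_le_mul_of_nonneg_right (mul_le_mul_of_nonneg_right (by linarith) hI0) hh.le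
  have hm2 : 2 * I * h ≤ 1 / 2 := by
    have h1 : h ≤ 1 / (4 * (I + 1)) := hht₅.trans (min_le_left _ _)
    rw [le_div_iff₀ (by positivity)] at h1
    nlinarith [hI0, hh.le]
  have hmδ : 2 * I * h * (2 * (2 * I + δ)) ≤ δ := by
    have h1 : h ≤ δ / (4 * (I + 1) * (2 * I + δ)) := hht₅.trans (min_le_right _ _)
    rw [le_div_iff₀ (by positivity)] at h1
    have : 0 ≤ h * (2 * I + δ) := by positivity
    nlinarith [hI0, hh.le]
  -- conclusion
  have hha : h < a := by
    have : 2 * h ≤ κ * h := by nlinarith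
    linarith
  have hΔ : 0 ≤ weilGroundEnergy (a - h) - weilGroundEnergy a :=
    sub_nonneg.2 (windowLipschitz_antitone (by linarith) (by linarith))
  refine edgeUpper_of_massDefect (I := I) (δ := δ) hΔ hμ0 hμ hm2 hmδ hh ?_
  linarith [hmain, hE, hE', hM]

/-- **Upper edge law, filter form.** If `log(1/r)/r · m_u(r) ≤ I` eventually as `r → 0⁺`, then
for every `δ > 0`: `ε(a − h) − ε(a) ≤ (I + δ)h` eventually as `h → 0⁺`.
[cite: Bombieri2000Weil, §6] -/
theorem eventually_sub_weilGroundEnergy_le_of_edgeMass (hu : IsWeilGroundState a u) {I : ℝ}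
    (hI : ∀ᶠ r in 𝓝[>] (0 : ℝ), Real.log (1 / r) / r * edgeMass u a r ≤ I) {δ : ℝ}
    (hδ : 0 < δ) :
    ∀ᶠ h in 𝓝[>] (0 : ℝ), weilGroundEnergy (a - h) - weilGroundEnergy a ≤ (I + δ) * h := by
  obtain ⟨b, hb, hbI⟩ := (nhdsGT_basis (0 : ℝ)).eventually_iff.1 hI
  obtain ⟨h₀, hh₀, H⟩ := exists_sub_weilGroundEnergy_le_of_edgeMass hu (r₁ := b / 2)
    (by positivity) (fun r hr hrb ↦ hbI ⟨hr, by linarith⟩) hδ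
  filter_upwards [(nhdsGT_basis (0 : ℝ)).mem_of_mem hh₀] with h hh
  exact H h hh.1 hh.2.le

/-- **Upper edge law under an edge intensity.** If `HasEdgeIntensity u a I` then for every
`δ > 0`: `ε(a − h) − ε(a) ≤ (I + δ)h` eventually as `h → 0⁺`. [cite: Bombieri2000Weil, §6] -/
theorem eventually_sub_weilGroundEnergy_le_of_hasEdgeIntensity (hu : IsWeilGroundState a u)
    {I : ℝ} (hI : HasEdgeIntensity u a I) {δ : ℝ} (hδ : 0 < δ) :
    ∀ᶠ h in 𝓝[>] (0 : ℝ), weilGroundEnergy (a - h) - weilGroundEnergy a ≤ (I + δ) * h := by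
  have h1 : ∀ᶠ r in 𝓝[>] (0 : ℝ), Real.log (1 / r) / r * edgeMass u a r ≤ I + δ / 2 :=
    (hI.eventually (Iic_mem_nhds (by linarith : I < I + δ / 2))).mono fun r hr ↦ hr
  filter_upwards [eventually_sub_weilGroundEnergy_le_of_edgeMass hu h1 (half_pos hδ)] with h hh
  linarith

/-- **`−ε'(a) ≤ I` at a differentiability window.** If `ε` is differentiable at `a` and
`log(1/r)/r · m_u(r) ≤ I` eventually for some ground state `u` of the window, then
`−ε'(a) ≤ I`. [cite: Bombieri2000Weil, §6] -/
theorem neg_deriv_weilGroundEnergy_le_of_edgeMass (hu : IsWeilGroundState a u) {I : ℝ}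
    (hI : ∀ᶠ r in 𝓝[>] (0 : ℝ), Real.log (1 / r) / r * edgeMass u a r ≤ I)
    (hd : DifferentiableAt ℝ weilGroundEnergy a) : -deriv weilGroundEnergy a ≤ I := by
  have ht : Tendsto (fun h : ℝ ↦ a - h) (𝓝[>] (0 : ℝ)) (𝓝[≠] a) := by
    refine tendsto_nhdsWithin_of_tendsto_nhds_of_eventually_within _ ?_ ?_
    · have : Tendsto (fun h : ℝ ↦ a - h) (𝓝 0) (𝓝 (a - 0)) := tendsto_const_nhds.sub tendsto_id
      rw [sub_zero] at this
      exact this.mono_left nhdsWithin_le_nhds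
    · filter_upwards [self_mem_nhdsWithin] with h hh
      rw [mem_compl_iff, mem_singleton_iff, sub_eq_self]
      exact ne_of_gt hh
  have hslope := ((hasDerivAt_iff_tendsto_slope.1 hd.hasDerivAt).comp ht).neg
  have hlim : Tendsto (fun h : ℝ ↦ (weilGroundEnergy (a - h) - weilGroundEnergy a) / h)
      (𝓝[>] (0 : ℝ)) (𝓝 (-deriv weilGroundEnergy a)) := by
    refine hslope.congr' ?_
    filter_upwards [self_mem_nhdsWithin] with h _
    simp only [Function.comp_apply, slope_def_field]
    rw [show a - h - a = -h by ring, div_neg, neg_neg]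
  refine le_of_forall_pos_le_add fun δ hδ ↦ le_of_tendsto hlim ?_
  filter_upwards [eventually_sub_weilGroundEnergy_le_of_edgeMass hu hI hδ, self_mem_nhdsWithin]
    with h hh hpos
  rwa [div_le_iff₀ (mem_Ioi.1 hpos)]

/-- **`−ε'(a) ≤ I(u)`**: at a differentiability window `a` of `ε`, every ground state with an
edge intensity `I` has `−ε'(a) ≤ I` (sharp constant `2c₀ = 1`). [cite: Bombieri2000Weil, §6] -/
theorem neg_deriv_weilGroundEnergy_le_of_hasEdgeIntensity (hu : IsWeilGroundState a u) {I : ℝ}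
    (hI : HasEdgeIntensity u a I) (hd : DifferentiableAt ℝ weilGroundEnergy a) :
    -deriv weilGroundEnergy a ≤ I := by
  refine le_of_forall_pos_le_add fun δ hδ ↦ ?_
  exact neg_deriv_weilGroundEnergy_le_of_edgeMass hu
    ((hI.eventually (Iic_mem_nhds (by linarith : I < I + δ))).mono fun r hr ↦ hr) hd

/-- **Upper half of the log-Pohozaev identity.** At a differentiability window `a` of `ε`, a
ground state with dilation virial `V` and edge intensity `I` has `V ≤ 2c₀·a·I`.
[cite: Bombieri2000Weil, §4 Thm 3, §6] -/
theorem virial_le_of_hasEdgeIntensity (hu : IsWeilGroundState a u)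
    (hd : DifferentiableAt ℝ weilGroundEnergy a) {V I : ℝ}
    (hV : HasDerivAt (weilDilationProfile a u) V 0) (hI : HasEdgeIntensity u a I) :
    V ≤ 2 * edgeLawKernelConstant * a * I := by
  have h1 := mul_deriv_weilGroundEnergy_eq_neg hu hd hV
  have h2 := mul_le_mul_of_nonneg_left (neg_deriv_weilGroundEnergy_le_of_hasEdgeIntensity hu hI hd)
    hu.pos.le
  rw [edgeLawKernelConstant]
  linarith

/-- **The log-Pohozaev identity from interior regularity alone.** At a differentiability window
`a` of `ε`, a ground state with virial `V`, edge intensity `I` and an `o(η)` interior dilation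
defect (R3) satisfies `V = 2c₀·a·I`. [cite: Bombieri2000Weil, §4 Thm 3, §6] -/
theorem virial_eq_of_interiorRegular (hu : IsWeilGroundState a u)
    (hd : DifferentiableAt ℝ weilGroundEnergy a) {V I : ℝ}
    (hV : HasDerivAt (weilDilationProfile a u) V 0) (hI : HasEdgeIntensity u a I)
    (htail : HasInteriorRegularDefect a u) : V = 2 * edgeLawKernelConstant * a * I :=
  le_antisymm (virial_le_of_hasEdgeIntensity hu hd hV hI)
    (virial_ge_of_interiorRegular hu hV hI htail)

/-- **Two-sided edge law from interior regularity**: `ε'(a) = −2c₀·I(u)` at a differentiability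
window, for every ground state with a virial, an edge intensity and (R3).
[cite: Bombieri2000Weil, §6] -/
theorem deriv_weilGroundEnergy_eq_of_interiorRegular (hu : IsWeilGroundState a u)
    (hd : DifferentiableAt ℝ weilGroundEnergy a) {V I : ℝ}
    (hV : HasDerivAt (weilDilationProfile a u) V 0) (hI : HasEdgeIntensity u a I)
    (htail : HasInteriorRegularDefect a u) :
    deriv weilGroundEnergy a = -(2 * edgeLawKernelConstant * I) := by
  have h1 := deriv_weilGroundEnergy_le_of_interiorRegular hu hd hV hI htail
  have h2 := neg_deriv_weilGroundEnergy_le_of_hasEdgeIntensity hu hI hd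
  rw [edgeLawKernelConstant] at h1 ⊢
  linarith

/-- **R6 from (R3) at differentiability windows.** If every ground state of the window `a` has
an `o(η)` interior dilation defect and `ε` is differentiable at `a`, then `WeilLogPohozaevAt a`.
[cite: Bombieri2000Weil, §4 Thm 3] -/
theorem weilLogPohozaevAt_of_interiorRegular
    (hR3 : ∀ u : ℝ → ℂ, IsWeilGroundState a u → HasInteriorRegularDefect a u)
    (hd : DifferentiableAt ℝ weilGroundEnergy a) : WeilLogPohozaevAt a :=
  fun u _ _ hu hV hI ↦ virial_eq_of_interiorRegular hu hd hV hI (hR3 u hu)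

/-- **(R3) ⇒ (R2′) at differentiability windows**: under (R3) the corner energy of a ground
state with a virial and an edge intensity is `o(h)`. [folklore] -/
theorem tendsto_cornerEnergy_div_zero_of_interiorRegular (hu : IsWeilGroundState a u)
    (hd : DifferentiableAt ℝ weilGroundEnergy a) {V I : ℝ}
    (hV : HasDerivAt (weilDilationProfile a u) V 0) (hI : HasEdgeIntensity u a I)
    (htail : HasInteriorRegularDefect a u) :
    Tendsto (fun h ↦ cornerEnergy a u h / h) (𝓝[>] 0) (𝓝 0) :=
  (tendsto_cornerEnergy_div_iff_virial_eq hu hV hI htail).2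
    (virial_eq_of_interiorRegular hu hd hV hI htail)

end Summit.RiemannHypothesis.RiemannHypothesis.Theorems.PfPersistence

end
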